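import Summits.QuantumFields.YangMills.Theorems.GrossTransferStubLinTestPointwiseRow
import Summits.QuantumFields.YangMills.Theorems.GrossTransferStubLinTestOfPointwise
import Summits.QuantumFields.YangMills.Theorems.UnitScaleGibbsSmoothLatticeCutoff
import Summits.QuantumFields.YangMills.Theorems.UnitScaleGibbsTruncatedPotentialEnergyMass
import Summits.QuantumFields.YangMills.Theorems.UnitScaleGibbsTestFieldSU2DressingPush
import Summits.QuantumFields.YangMills.Theorems.UnitScaleGibbsTestFieldSU2Dressing
import Summits.QuantumFields.YangMills.Theorems.GrossTransferStubLinTestEnergyMassRows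
import Summits.QuantumFields.YangMills.Theorems.GrossTransferStubLinTestCollarFloorRow
import Summits.QuantumFields.YangMills.Theorems.GrossTransferStubLinTestWeightReadoutRows
import Summits.QuantumFields.YangMills.Theorems.GrossTransferStubLinTestMassRow
import Summits.QuantumFields.YangMills.Theorems.CovariantDischargeFreeGreenKernelBoxBounds
import HarnessLib

/-!
# `GrossTransferStubLinTestPointwisePackage` — KNIT-E FILE 2: THE POINTWISE PACKAGE OF `stub_linTest` (`main_estimate`, `pointwisePackage`) for the reference
# orientation `(1,2)` (LINE 28 «GrossTransfer» v3.2, skeleton of record `Cruxes/HistoryTailL/Lines/gross_transfer.lean`; crux `RevelationMartingale.MeanDeviationL`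
# stmt-QuantumFields-23083 ∕ `UnitScaleTilt.HistoryTailL` stmt-QuantumFields-19936)

Cell `ym3-torus` (YM ladder rung R3 = continuum SU(2) Yang–Mills on T³ — a RUNG, NOT the Clay problem: not d = 4, not infinite volume, not a mass gap).
Skeleton, letters, rows R1–R7 and the P1–P7 plugs: pen of record ★ym-ust-19936-w2 g15; P8 (the assembly) and this landing: width seat `ym3-torus-px13` g12,
pen on `main_estimate` (LEAD ★w1-19936 2026-08-30T00:19:30Z, ★★OWNER WORD 65); split partner ym-ust-19936-w2 g16 ((W) ✓`…Windows`, (Q) ✓`…ProxySide`,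
✓`…Assembly`, letters `N := 260`, `ω9 := (9∕2)·ω`).  Helper `--supports stmt-QuantumFields-23083`.  THEOREMS ONLY (0 `def`, 0 `sorry`, default heartbeats).

WHAT.  ★★★`main_estimate`: for every `L` there is `C ≥ 0` such that for the T³ family member `F` with `F.L = L`, `0 < γ ≤ 1∕8`, `1 ≤ j`, `260·j ≤ K` and a
level-`j` plaquette `a` of orientation `(1,2)`, there are a dressing box `[lo, hi]` of side `n`, three test fields `u_α` (dressed pushes of the truncated
Green potential of the cone read-out, `𝔰𝔲(2)`-valued, supported in the box with the off-tree∕margin row) and bond weights `ω ≥ 0` supported in the box, with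
`n ≤ C·L^{16j}`, energy `Σ_p‖(du_α)_p‖² ≤ C·L^j`, mass `Σ_b‖u_α b‖² ≤ C·L^{16j}`, floor `n·Σ_b ω_b ≤ C·L^j`, and ON THE SMALL-FIELD EVENT of the box at
`θ_K = (γL^{−K})^{3∕8}`: `dist₁(Ū^j(U)∂a)² ≤ C·Σ_α (∂_{u_α}A(U^{axialGauge}))² + Σ_b ω_b·dist₁(U^{axialGauge}_b)² + C·γ·L^{−(K−j)}`.
Objects in ABSOLUTE `castSite` coordinates: cone base `z₀`, cone radius `R₀ = ((d+4)L+2)·Σ_{k<j}L^k`, cutoff radius `R = (R₀+12)·L^{3j}`, `ℓ0 = R₀ + 2`,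
`lo = z₀ − (3R+2)`, `hi = z₀ + (3R+4)`, `n = 6R+6`.  ROWS BY NAME: (R4) box size; (R5) ✓`energy_row_le` (w5 g17); (R6) ✓DRESS + ✓KNIT-D `sum_sq_truncated_le`;
(R7) ✓`collarFloor_row_le'` × 9∕2; (R8) ✓`GrossTransferStubLinTestPointwiseRow.pointwise_row` (P1–P8).  ★★★`pointwisePackage` = the hypothesis `hP` of
✓`GrossTransferStubLinTestOfPointwise.stub_linTest_of_pointwisePackage'` with `c = 16`, `N = 260`, `γ₁ = 1∕8`.

HONEST SCOPE.  `main_estimate` proves the POINTWISE PACKAGE row of LINE 28; the registered `stub_linTest` follows by ✓E1′ in a separate closing file (LEAD's ∕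
ideator's word); `stub_meanDeviationDeep` (= 23134), `MeanDeviationL` 23083, `HistoryTailL` 19936, the rung `YM3TorusSU2` are NOT proved; no summit statement
is proved; the Yang–Mills mass gap is NOT proved.
References: [GrossCMP1983] Thm 2.2; [Balaban1985Averaging] Prop. 1 (51) pp. 25–26, (19)–(20) p. 21; [Balaban1985UV3] (1)–(3) p. 256; [Balaban1984PropagatorsII] (1.9).
-/

noncomputable section

open MeasureTheory
open scoped BigOperators Matrix.Norms.Frobenius
open Literature.MathematicalPhysics.QuantumFieldTheory.Balaban1983to89
open Literature.MathematicalPhysics.QuantumFieldTheory.Balaban1983to89.T3ContinuumYM3Torus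
open Literature.MathematicalPhysics.QuantumFieldTheory.Balaban1983to89.T3UnitScaleTilt
open Literature.MathematicalPhysics.QuantumFieldTheory.Balaban1983to89.T3UnitLawDensityEML (ℰp)
open Literature.MathematicalPhysics.QuantumFieldTheory.Balaban1983to89.T4AxialGaugeSmallField (axialGauge boxPlaqs boxBonds castSite)
open Literature.MathematicalPhysics.QuantumFieldTheory.Balaban1983to89.B7Prop1Explicit (e)
open Literature.MathematicalPhysics.QuantumFieldTheory.Balaban1983to89.B8Lemma1NonAbelian (lowPart)
open Literature.MathematicalPhysics.QuantumLattice (fundamentalRep)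
open Summit.QuantumFields.YangMills.Theorems.UnitScaleGibbsActionDerivativeSlotCalculus (actionDeriv actionDeriv₂ slotBond)

open Literature.Probability.LatticeModels (latticeGreen)
open Literature.MathematicalPhysics.QuantumFieldTheory.Balaban1983to89.B4Eq19LatticeOperators (Zd unitVec box mem_box abs_unitVec_apply_le card_box box_mono)
open Summit.QuantumFields.YangMills.Theorems.UnitScaleGibbsBlockPlaquetteLinWeight (linWeight)

namespace Summit.QuantumFields.YangMills.Theorems.GrossTransferStubLinTestPointwisePackage

/-- ★★★ **THE MAIN ESTIMATE** — the pointwise package with the exponents fixed (`c = 16`, `N = 260`, `γ₁ = 1∕8`); rows R1–R8 by name (module docstring).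
[cite: GrossCMP1983, Thm 2.2] [cite: Balaban1985Averaging, Prop. 1 (51) pp.25-26] -/
theorem main_estimate :
    ∀ (L : ℕ), ∃ C : ℝ, 0 ≤ C ∧
        ∀ (F : T3Family) (γ : ℝ), F.L = L → 0 < γ → γ ≤ 1 / 8 → ∀ (K j : ℕ), 1 ≤ j → 260 * j ≤ K →
          ∀ a : Plaq (F.P K) j, a.μ.val = 1 → a.ν.val = 2 →
            ∃ (lo hi : Fin (F.P K).d → ℤ) (n : ℕ) (u : Fin 3 → PBond (F.P K) 0 → Matrix (Fin 2) (Fin 2) ℂ)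
              (ω : PBond (F.P K) 0 → ℝ),
              (∀ κ, lo κ ≤ hi κ ∧ hi κ ≤ lo κ + n) ∧ 2 * n + 6 ≤ (F.P K).sitesPerDir 0 ∧
              (∀ α b, star (u α b) = -(u α b) ∧ (u α b).trace = 0) ∧
              (∀ α b, u α b ≠ 0 → ∃ x : Fin (F.P K).d → ℤ,
                  lo + 1 ≤ x ∧ x + e b.dir + 1 ≤ hi ∧ b.src = castSite x ∧ lowPart b.dir (x - lo) ≠ 0) ∧
              (n : ℝ) ≤ C * (L : ℝ) ^ (16 * j) ∧
              (∀ α, ∑ p : Plaq (F.P K) 0, ‖u α (slotBond p 0) + u α (slotBond p 1) - u α (slotBond p 2) - u α (slotBond p 3)‖ ^ 2 ≤ C * (L : ℝ) ^ j) ∧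
              (∀ α, ∑ b : PBond (F.P K) 0, ‖u α b‖ ^ 2 ≤ C * (L : ℝ) ^ (16 * j)) ∧
              (∀ b, 0 ≤ ω b) ∧ (∀ b, ω b ≠ 0 → b ∈ (boxBonds lo hi : Set (PBond (F.P K) 0))) ∧
              (n : ℝ) * ∑ b : PBond (F.P K) 0, ω b ≤ C * (L : ℝ) ^ j ∧
              (∀ U : GaugeField (F.P K) 0 (Matrix.specialUnitaryGroup (Fin 2) ℂ),
                PlaqSmallOn (boxPlaqs lo hi) ((γ * ((L : ℝ)⁻¹) ^ K) ^ ((3 : ℝ) / 8)) U →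
                (GaugeGroup.dist1 (GaugeField.plaqHol
                    (Averaging.iter (fun i' => BlockAveraging.blockAvg (P := F.P K) (j := i') ℰp) j U) a)) ^ 2
                  ≤ C * ∑ α, (actionDeriv (fundamentalRep (Fin 2)) (u α) (GaugeField.gaugeAct (axialGauge U lo hi) U)) ^ 2
                    + ∑ b, ω b * (GaugeGroup.dist1 (GaugeField.gaugeAct (axialGauge U lo hi) U b)) ^ 2
                    + C * (γ * ((L : ℝ)⁻¹) ^ (K - j))) := by
  intro L
  classical
  -- STEP 0 — the L-dependent constant `C := max Cbox C5 C6 C7 C8` dominating the five rows' constants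
  -- the row constants (each fixed when its row is filled) and `C := their max`
  obtain ⟨Cbox, hCbox⟩ : ∃ Cbox : ℝ, Cbox = 42 * (L : ℝ) + 96 := ⟨_, rfl⟩
  have hCbox0 : 0 ≤ Cbox := by rw [hCbox]; positivity
  obtain ⟨C₁k, C₂k, hC₁k, hC₂k, hKer⟩ := CovariantDischargeFreeGreenKernelBoxBounds.exists_fdiff_latticeGreen_box_bounds
  obtain ⟨C5, hC5⟩ : ∃ C5 : ℝ, C5 = 1312 + 34992 * C₁k ^ 2 := ⟨_, rfl⟩   -- (R5) energy constant (w5 g17 `energy_row_le`)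
  have hC50 : 0 ≤ C5 := by rw [hC5]; positivity
  obtain ⟨K₀, hK₀⟩ : ∃ K₀ : ℝ, K₀ = ∑ e' : Fin 3, |latticeGreen (unitVec e') - latticeGreen (0 : Zd 3)| := ⟨_, rfl⟩
  have hK₀0 : 0 ≤ K₀ := by rw [hK₀]; exact Finset.sum_nonneg fun _ _ => abs_nonneg _
  obtain ⟨C6, hC6⟩ : ∃ C6 : ℝ, C6 = 122 * (42 * (L : ℝ) + 85) ^ 3 * (K₀ + C₁k) ^ 2 := ⟨_, rfl⟩
  have hC60 : 0 ≤ C6 := by rw [hC6]; positivity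
  obtain ⟨C7, hC7⟩ : ∃ C7 : ℝ, C7 = 9 / 2 * (9072 * 370440 ^ 2 * (C₁k + C₂k) ^ 2) := ⟨_, rfl⟩   -- (R7) collar-floor constant × 9∕2 (ω9 := (9∕2)·ω, w2 g16's letter)
  have hC70 : 0 ≤ C7 := by rw [hC7]; positivity
  -- (R8) the envelope `CE` of the five small terms of P8 (all `≤ CE·L^{47j+18}·θ²`, ✓`…PointwiseNumbers.small_terms_le` + ✓(W) `rem_le`) and `C8 := 3·CE²`
  obtain ⟨CE, hCE⟩ : ∃ CE : ℝ, CE = 3244536 * (K₀ + 26 * C₁k) + 1 / 2 + (L : ℝ) ^ 19 := ⟨_, rfl⟩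
  obtain ⟨C8, hC8⟩ : ∃ C8 : ℝ, C8 = 3 * CE ^ 2 := ⟨_, rfl⟩
  have hC80 : 0 ≤ C8 := by rw [hC8]; positivity
  obtain ⟨C, hCdef⟩ : ∃ C : ℝ, C = max Cbox (max C5 (max C6 (max C7 C8))) := ⟨_, rfl⟩
  have hCge4 : Cbox ≤ C := by rw [hCdef]; exact le_max_left _ _
  have hCge5 : C5 ≤ C := by rw [hCdef]; exact (le_max_left _ _).trans (le_max_right _ _)
  have hCge6 : C6 ≤ C := by rw [hCdef]; exact ((le_max_left _ _).trans (le_max_right _ _)).trans (le_max_right _ _)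
  have hCge7 : C7 ≤ C := by rw [hCdef]; exact (((le_max_left _ _).trans (le_max_right _ _)).trans (le_max_right _ _)).trans (le_max_right _ _)
  have hCge8 : C8 ≤ C := by rw [hCdef]; exact (((le_max_right _ _).trans (le_max_right _ _)).trans (le_max_right _ _)).trans (le_max_right _ _)
  refine ⟨C, hCbox0.trans hCge4, ?_⟩
  intro F γ hFL hγ hγ8 K j hj hKj260 a hμ hν
  have hKj120 : 120 * j ≤ K := by omega
  have hKj : 60 * j ≤ K := by omega
  -- STEP 1 — geometry: the cone under `a`, its integer base point `z₀`, radii and the dressing box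
  have hd : (F.P K).d = 3 := rfl
  obtain ⟨cn, hcnj, hcn⟩ := UnitScaleGibbsBlockPlaquetteLinearisationOnBoxEvent.exists_cone (P := F.P K) j a.src
  obtain ⟨z₀, -, -, hz₀, -, -, -⟩ := UnitScaleGibbsBlockPlaquetteSmallFieldBoxBridge.exists_box_around (cn 0) 0
  obtain ⟨R₀, hR₀⟩ : ∃ R₀ : ℕ, R₀ = (((F.P K).d + 4) * (F.P K).L + 2) * ∑ k ∈ Finset.range j, (F.P K).L ^ k := ⟨_, rfl⟩
  obtain ⟨R, hR⟩ : ∃ R : ℕ, R = (R₀ + 12) * (F.P K).L ^ (3 * j) := ⟨_, rfl⟩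
  set lo : Fin (F.P K).d → ℤ := fun κ => z₀ κ - (3 * R + 2) with hlo
  set hi : Fin (F.P K).d → ℤ := fun κ => z₀ κ + (3 * R + 4) with hhi
  obtain ⟨n, hn⟩ : ∃ n : ℕ, n = 6 * R + 6 := ⟨_, rfl⟩
  have hbox : ∀ κ, lo κ ≤ hi κ ∧ hi κ ≤ lo κ + n := fun κ => by
    simp only [hlo, hhi, hn]; push_cast; constructor <;> linarith
  -- (R1') the box fits the torus: `2n + 6 ≤ sitesPerDir 0 = 2·L^{m+K}` in the window `60·j ≤ K`
  have hn6 : 2 * n + 6 ≤ (F.P K).sitesPerDir 0 := by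
    have hsites : (F.P K).sitesPerDir 0 = 2 * F.L ^ (F.m + K) := by
      simp [T3Family.P, Params.sitesPerDir, Literature.MathematicalPhysics.QuantumFieldTheory.Balaban1985CMP102.Setting.params3]
    have hL2 : 2 ≤ F.L := F.hL.2
    have hR₀le : R₀ ≤ (7 * F.L + 2) * F.L ^ j := by
      have h := UnitScaleGibbsBlockPlaquetteLinearisationOnBoxEvent.sum_pow_lt_le (P := F.P K) j
      have hd3 : ((F.P K).d + 4) * (F.P K).L + 2 = 7 * F.L + 2 := by rw [hd]; rfl
      calc R₀ = (((F.P K).d + 4) * (F.P K).L + 2) * ∑ k ∈ Finset.range j, (F.P K).L ^ k := hR₀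
        _ ≤ (((F.P K).d + 4) * (F.P K).L + 2) * (F.P K).L ^ j := Nat.mul_le_mul_left _ h
        _ = (7 * F.L + 2) * F.L ^ j := by rw [hd3]; rfl
    have h := GrossTransferStubLinTestPointwiseNumbers.box_fits (m := F.m) hL2 hj hKj hR₀le
    rw [hsites, hn, hR]
    have : (F.P K).L = F.L := rfl
    rw [this]
    omega
  -- STEP 2 — the `ℤ³` objects
  have hR1 : 1 ≤ R := by
    have hL1 : 1 ≤ (F.P K).L := le_trans (by norm_num) F.hL.2
    have h1 : 1 ≤ (F.P K).L ^ (3 * j) := Nat.one_le_pow _ _ hL1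
    have h2 : 1 ≤ R₀ + 12 := by omega
    rw [hR]; exact le_trans (by norm_num) (Nat.mul_le_mul h2 h1)
  -- the (Z-a…e) source radius `ℓ0 := R₀ + 2` (the cone box plus the plaquette corners): `box z₀ ℓ0 = piFinset Icc (z₀ − ℓ0) (z₀ + ℓ0)`
  obtain ⟨ℓ0, hℓ0⟩ : ∃ ℓ0 : ℕ, ℓ0 = R₀ + 2 := ⟨_, rfl⟩
  -- the antisymmetrised read-out of the averaging weights on the cone box
  obtain ⟨wt, hwt⟩ : ∃ wt : Zd (F.P K).d → Fin (F.P K).d → Fin (F.P K).d → ℝ, ∀ y μ ν, wt y μ ν =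
      if y ∈ box z₀ (ℓ0 : ℤ) then (if h : μ < ν then linWeight j a ⟨castSite y, μ, ν, h⟩ else if h' : ν < μ then -linWeight j a ⟨castSite y, ν, μ, h'⟩ else 0)
      else 0 := ⟨_, fun _ _ _ => rfl⟩
  obtain ⟨βt, hβt⟩ : ∃ βt : Zd (F.P K).d → Fin (F.P K).d → Fin (F.P K).d → ℝ, ∀ x μ ν, βt x μ ν = ∑ y ∈ box z₀ (ℓ0 : ℤ), latticeGreen (x - y) / 2 * wt y μ ν :=
    ⟨_, fun _ _ _ => rfl⟩
  obtain ⟨at', hat⟩ : ∃ at' : Zd (F.P K).d → Fin (F.P K).d → ℝ, ∀ x ν, at' x ν = ∑ μ, (βt (x - unitVec μ) μ ν - βt x μ ν) := ⟨_, fun _ _ => rfl⟩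
  obtain ⟨γt, hγt⟩ : ∃ γt : Zd (F.P K).d → Fin (F.P K).d → Fin (F.P K).d → Fin (F.P K).d → ℝ, ∀ x κ μ ν, γt x κ μ ν =
      (βt (x + unitVec κ) μ ν - βt x μ ν) - (βt (x + unitVec μ) κ ν - βt x κ ν) + (βt (x + unitVec ν) κ μ - βt x κ μ) := ⟨_, fun _ _ _ _ => rfl⟩
  obtain ⟨χ, hχ01, hχ1, hχ0, hχp, hχm, hχ2⟩ := UnitScaleGibbsSmoothLatticeCutoff.exists_smooth_cutoff z₀ hR1
  obtain ⟨aR, haR⟩ : ∃ aR : Zd (F.P K).d → Fin (F.P K).d → ℝ, ∀ x ν, aR x ν = χ x * at' x ν := ⟨_, fun _ _ => rfl⟩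
  obtain ⟨daR, hdaR⟩ : ∃ daR : Zd (F.P K).d → Fin (F.P K).d → Fin (F.P K).d → ℝ, ∀ x μ ν, daR x μ ν = (aR (x + unitVec μ) ν - aR x ν) - (aR (x + unitVec ν) μ - aR x μ) :=
    ⟨_, fun _ _ _ => rfl⟩
  -- (S2a) no time components: `wt y μ 0 = wt y 0 ν = 0`, hence `βt · μ 0 = 0` and `at' x 0 = 0`
  have hwt0 : ∀ y μ, wt y μ 0 = 0 := by
    intro y μ
    rw [hwt]
    split_ifs with hy h h'
    · exact absurd h (Nat.not_lt_zero _)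
    · -- `0 < μ`: the plaquette `⟨castSite y, 0, μ⟩` has `linWeight = 0` unless its orientation is `a`'s, i.e. `0 = a.μ = 1` — impossible
      have hor := UnitScaleGibbsNormalEquationNetFluxLinWeight.linWeight_eq_zero_of_orientation_ne j a ⟨castSite y, 0, μ, h'⟩ (by
        rintro ⟨h0, -⟩; have := congrArg Fin.val h0; rw [hμ] at this; exact absurd this (by simp))
      rw [hor, neg_zero]
    · rfl
    · rfl
  have hat0 : ∀ x, at' x 0 = 0 := by
    intro x
    rw [hat]
    refine Finset.sum_eq_zero fun μ _ => ?_
    rw [hβt, hβt, ← Finset.sum_sub_distrib]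
    refine Finset.sum_eq_zero fun y _ => ?_
    rw [hwt0, mul_zero, mul_zero, sub_self]
  -- STEP 3 — the torus test fields: push `aR` to the bonds of the dressing box
  have hNbox : ∀ κ, hi κ - lo κ < (F.P K).sitesPerDir 0 := by
    intro κ
    have h := hbox κ
    have : (n : ℤ) < (F.P K).sitesPerDir 0 := by exact_mod_cast (show n < (F.P K).sitesPerDir 0 by omega)
    linarith [h.2]
  obtain ⟨u0, hu0, hu0off⟩ := UnitScaleGibbsTemporalGaugePrimitiveTorus.exists_push (P := F.P K) (j := 0) hNbox aR
  set τ : Fin 3 → Matrix (Fin 2) (Fin 2) ℂ := fun α => Complex.I • B10Eq18SigmaSU2.pauli α with hτ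
  set u : Fin 3 → PBond (F.P K) 0 → Matrix (Fin 2) (Fin 2) ℂ := fun α b => ((u0 b : ℝ) : ℂ) • τ α with hu
  -- (R2) skew-Hermitian traceless letters
  have hsu : ∀ α b, star (u α b) = -(u α b) ∧ (u α b).trace = 0 := by
    intro α b
    simp only [hu, hτ]
    refine ⟨?_, ?_⟩
    · rw [star_smul, Matrix.star_eq_conjTranspose, UnitScaleGibbsLinProxySU2Letters.conjTranspose_I_smul_pauli, smul_neg]
      simp
    · rw [Matrix.trace_smul, UnitScaleGibbsLinProxySU2Letters.trace_I_smul_pauli, smul_zero]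
  -- (R3) support ∕ margin ∕ off-tree, by ✓`push_support_of_margin`
  have haRsupp : ∀ x μ, aR x μ ≠ 0 → μ ≠ ⟨0, by rw [hd]; norm_num⟩ ∧ lo + 1 ≤ x ∧ x + unitVec μ + 1 ≤ hi ∧ lo ⟨0, by rw [hd]; norm_num⟩ + 2 ≤ x ⟨0, by rw [hd]; norm_num⟩ := by
    intro x μ hx
    rw [haR] at hx
    have hχx : χ x ≠ 0 := left_ne_zero_of_mul hx
    have hax : at' x μ ≠ 0 := right_ne_zero_of_mul hx
    have hxbox : x ∈ box z₀ (3 * (R : ℤ)) := by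
      by_contra hnot; exact hχx (hχ0 x (by exact_mod_cast hnot))
    rw [mem_box] at hxbox
    have hμ0 : μ ≠ ⟨0, by rw [hd]; norm_num⟩ := by
      intro hμ0; apply hax; rw [hμ0]; exact hat0 x
    refine ⟨hμ0, fun κ => ?_, fun κ => ?_, ?_⟩
    · have := hxbox κ; rw [abs_le] at this; simp only [hlo, Pi.add_apply, Pi.one_apply]; linarith
    · have := hxbox κ; rw [abs_le] at this
      have hu1 : (unitVec μ : Zd (F.P K).d) κ ≤ 1 := le_trans (le_abs_self _) (abs_unitVec_apply_le μ κ)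
      simp only [hhi, Pi.add_apply, Pi.one_apply]; linarith
    · have := hxbox ⟨0, by rw [hd]; norm_num⟩; rw [abs_le] at this; simp only [hlo]; linarith
  have hsupp : ∀ α b, u α b ≠ 0 → ∃ x : Fin (F.P K).d → ℤ,
      lo + 1 ≤ x ∧ x + e b.dir + 1 ≤ hi ∧ b.src = castSite x ∧ lowPart b.dir (x - lo) ≠ 0 := by
    intro α b hb
    have hb0 : u0 b ≠ 0 := by
      intro h0; apply hb; simp only [hu, h0, Complex.ofReal_zero, zero_smul]
    exact UnitScaleGibbsTemporalGaugePrimitiveTorus.push_support_of_margin (P := F.P K) (j := 0) (by rw [hd]; norm_num) aR haRsupp u0 hu0 hu0off b hb0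
  -- STEP 2b — the cutoff commutators, their coboundary, the collar mass `W` and the bond weights `ω`
  obtain ⟨E1, hE1⟩ : ∃ E1 : Zd (F.P K).d → Fin (F.P K).d → Fin (F.P K).d → ℝ, ∀ x μ ν,
      E1 x μ ν = (χ (x + unitVec μ) - χ x) * at' (x + unitVec μ) ν - (χ (x + unitVec ν) - χ x) * at' (x + unitVec ν) μ := ⟨_, fun _ _ _ => rfl⟩
  obtain ⟨C2, hC2⟩ : ∃ C2 : Zd (F.P K).d → Fin (F.P K).d → Fin (F.P K).d → ℝ, ∀ x μ ν,
      C2 x μ ν = ∑ κ, (χ x - χ (x - unitVec κ)) * γt (x - unitVec κ) κ μ ν := ⟨_, fun _ _ _ => rfl⟩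
  obtain ⟨σ, hσ⟩ : ∃ σ : Zd (F.P K).d → Fin (F.P K).d → Fin (F.P K).d → ℝ, ∀ x μ ν, σ x μ ν = E1 x μ ν - C2 x μ ν := ⟨_, fun _ _ _ => rfl⟩
  obtain ⟨δσ, hδσ⟩ : ∃ δσ : Zd (F.P K).d → Fin (F.P K).d → ℝ, ∀ y ν, δσ y ν = ∑ μ, (σ (y - unitVec μ) μ ν - σ y μ ν) := ⟨_, fun _ _ => rfl⟩
  -- NB (23:45Z correction): `δσ` is supported in `Q_{3R+2}(z₀)` (σ in `Q_{3R+1}`, one more backward difference), so the collar mass `W` sums over `Q_{3R+2}`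
  obtain ⟨W, hW⟩ : ∃ W : ℝ, W = ∑ y ∈ box z₀ (3 * (R : ℤ) + 2), ∑ ν, |δσ y ν| := ⟨_, rfl⟩
  have hW0 : 0 ≤ W := by rw [hW]; exact Finset.sum_nonneg fun _ _ => Finset.sum_nonneg fun _ _ => abs_nonneg _
  obtain ⟨ω, hω, hωoff⟩ := UnitScaleGibbsTemporalGaugePrimitiveTorus.exists_push (P := F.P K) (j := 0) hNbox (fun y ν => 192 * W * |δσ y ν|)
  have hω0 : ∀ b, 0 ≤ ω b := by
    intro b
    by_cases h : ∃ y : Fin (F.P K).d → ℤ, lo ≤ y ∧ y + e b.dir ≤ hi ∧ b.src = castSite y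
    · obtain ⟨y, hy, hyhi, hsrc⟩ := h
      have hb : b = ⟨castSite y, b.dir⟩ := by cases b; simp only at hsrc; simp [hsrc]
      rw [hb, hω y b.dir hy hyhi]; positivity
    · rw [hωoff b h]
  have hωsupp : ∀ b, ω b ≠ 0 → b ∈ (boxBonds lo hi : Set (PBond (F.P K) 0)) := by
    intro b hb
    by_contra hnot
    exact hb (hωoff b fun ⟨y, hy, hyhi, hsrc⟩ => hnot ⟨y, hy, hyhi, hsrc⟩)
  -- the package's bond weights: `ω9 := (9∕2)·ω` (w2 g16's letter; the squares of P8 put `864 = (9∕2)·192` in front of `W·Σ|δσ|dist₁²`)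
  set ω9 : PBond (F.P K) 0 → ℝ := fun b => 9 / 2 * ω b with hω9
  have hω90 : ∀ b, 0 ≤ ω9 b := fun b => by simp only [hω9]; exact mul_nonneg (by norm_num) (hω0 b)
  have hω9supp : ∀ b, ω9 b ≠ 0 → b ∈ (boxBonds lo hi : Set (PBond (F.P K) 0)) := fun b hb =>
    hωsupp b fun h => hb (by simp only [hω9, h, mul_zero])
  -- shared geometry of the read-outs: the cone plaquettes live in `boxPlaqs (z₀ − ℓ0) (z₀ + ℓ0)`, whose integer box is `box z₀ ℓ0`
  -- the read-out's `ℓ¹` mass (✓w5 M0-ROWS `readout_abs_sum_le`: `M₀ ≤ 2(L·L)^j ≤ 9(L²)^j`); the chart box `Q_{ℓ0}` does not wrap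
  have hℓ0lt : 2 * (ℓ0 : ℤ) < (F.P K).sitesPerDir 0 := by
    have hLpos : 0 < (F.P K).L ^ (3 * j) := pow_pos (lt_of_lt_of_le (by norm_num) F.hL.2) _
    have hRge : R₀ + 12 ≤ R := by rw [hR]; exact Nat.le_mul_of_pos_right _ hLpos
    have h1 : 2 * ℓ0 < (F.P K).sitesPerDir 0 := by rw [hℓ0]; omega
    exact_mod_cast h1
  have hM0 : ∑ μ, ∑ ν', ∑ y ∈ box z₀ (ℓ0 : ℤ), |wt y μ ν'| ≤ 9 * ((L : ℝ) ^ 2) ^ j := by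
    have h := GrossTransferStubLinTestWeightReadoutRows.readout_abs_sum_le a z₀ ℓ0 wt hwt hℓ0lt
    have hPL : ((F.P K).L : ℝ) = (L : ℝ) := by rw [← hFL]; rfl
    rw [hPL, ← sq] at h
    have h0 : (0 : ℝ) ≤ ((L : ℝ) ^ 2) ^ j := by positivity
    linarith only [h, h0]
  -- THE REMAINING ROWS (R4 box size · R5 energy · R6 mass · R7 collar floor · R8 pointwise) and the constant `C` (STEP 0):
  refine ⟨lo, hi, n, u, ω9, hbox, hn6, hsu, hsupp, ?_, ?_, ?_, hω90, hω9supp, ?_, ?_⟩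
  · -- (R4) `n = 6R+6 ≤ (42L+96)·L^{4j} ≤ C·L^{16j}` (✓(W) `radius_le` + `side_le`)
    have hL1r : (1 : ℝ) ≤ (L : ℝ) := by rw [← hFL]; exact_mod_cast (le_trans (by norm_num) F.hL.2)
    have hR₀le : R₀ ≤ (7 * F.L + 2) * F.L ^ j := by rw [hR₀]; exact GrossTransferStubLinTestWindows.radius_le (F.P K) hd j
    have hnle : (n : ℝ) ≤ (42 * (L : ℝ) + 96) * (L : ℝ) ^ (4 * j) := by
      have h := GrossTransferStubLinTestWindows.side_le F.hL.2 hR₀le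
      have hPLn : (F.P K).L = F.L := rfl
      rw [← hPLn, ← hR, ← hn, hPLn, hFL] at h
      exact_mod_cast h
    have hpow : (L : ℝ) ^ (4 * j) ≤ (L : ℝ) ^ (16 * j) := pow_le_pow_right₀ hL1r (by omega)
    calc (n : ℝ) ≤ (42 * (L : ℝ) + 96) * (L : ℝ) ^ (4 * j) := hnle
      _ ≤ Cbox * (L : ℝ) ^ (16 * j) := by rw [hCbox]; exact mul_le_mul_of_nonneg_left hpow (by positivity)
      _ ≤ C * (L : ℝ) ^ (16 * j) := mul_le_mul_of_nonneg_right hCge4 (by positivity)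
  · -- (R5) energy — ✓w5 g17 `GrossTransferStubLinTestEnergyMassRows.energy_row_le` (over ✓DRESS + ✓KNIT-D + ✓M0-ROWS), plugged with the size rows of this box
    intro α
    have hjmK : j ≤ (F.P K).m + (F.P K).K := by
      have : (F.P K).K = K := rfl
      rw [this]; omega
    have hLpos : 0 < (F.P K).L ^ (3 * j) := pow_pos (lt_of_lt_of_le (by norm_num) F.hL.2) _
    have hRge : R₀ + 12 ≤ R := by rw [hR]; exact Nat.le_mul_of_pos_right _ hLpos
    have hRge8 : 8 * (R₀ + 12) ≤ R := by
      rw [hR, mul_comm]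
      refine Nat.mul_le_mul_left _ ?_
      calc 8 = 2 ^ 3 := by norm_num
        _ ≤ (F.P K).L ^ 3 := Nat.pow_le_pow_left F.hL.2 3
        _ ≤ (F.P K).L ^ (3 * j) := Nat.pow_le_pow_right (lt_of_lt_of_le (by norm_num) F.hL.2) (by omega)
    obtain ⟨N', hN'⟩ : ∃ N' : ℕ, N' = R - ℓ0 - 2 := ⟨_, rfl⟩
    have hN1 : 1 ≤ N' := by rw [hN', hℓ0]; omega
    have hNR : (N' : ℤ) + ℓ0 + 2 ≤ R := by
      have : N' + ℓ0 + 2 ≤ R := by rw [hN', hℓ0]; omega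
      exact_mod_cast this
    have hRN : R ≤ 2 * N' := by rw [hN', hℓ0]; omega
    have hRL : 12 * F.L ^ (3 * j) ≤ R := by
      have : (F.P K).L = F.L := rfl
      rw [hR, this]; exact Nat.mul_le_mul_right _ (by omega)
    have haR1 : ∀ x μ, aR x μ ≠ 0 → lo + 1 ≤ x ∧ x + unitVec μ + 1 ≤ hi := fun x μ hx => ⟨(haRsupp x μ hx).2.1, (haRsupp x μ hx).2.2.1⟩
    have h := GrossTransferStubLinTestEnergyMassRows.energy_row_le F K hNbox hC₁k (fun e w n hn hw => (hKer e).1 w n hn hw) a hjmK wt βt at' γt z₀ ℓ0 hℓ0lt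
      hwt hβt hat hγt χ aR daR R hχ01 hχ1 hχ0 hχp haR hdaR haR1 u0 hu0 hu0off N' hN1 hNR hRN hRL α
    refine h.trans ?_
    have hL0 : (0 : ℝ) ≤ (L : ℝ) := Nat.cast_nonneg L
    rw [hFL]
    calc (1312 + 34992 * C₁k ^ 2) * (L : ℝ) ^ j = C5 * (L : ℝ) ^ j := by rw [hC5]
      _ ≤ C * (L : ℝ) ^ j := mul_le_mul_of_nonneg_right hCge5 (pow_nonneg hL0 _)
  · -- (R6) mass — ✓w2 g16 `GrossTransferStubLinTestMassRow.mass_row_le` (✓DRESS `sum_norm_sq_dress` + ✓KNIT-D `sum_sq_truncated_le`), size row ✓(W) `diam_le`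
    intro α
    have hR₀le : R₀ ≤ (7 * F.L + 2) * F.L ^ j := by rw [hR₀]; exact GrossTransferStubLinTestWindows.radius_le (F.P K) hd j
    have hRle : 6 * R + 1 ≤ (42 * F.L + 85) * F.L ^ (4 * j) := by
      have h := GrossTransferStubLinTestWindows.diam_le F.hL.2 hR₀le
      have hPLn : (F.P K).L = F.L := rfl
      rw [hR, hPLn]; exact h
    have hχ0' : ∀ x, x ∉ box z₀ (3 * (R : ℤ)) → χ x = 0 := fun x hx => hχ0 x hx
    have haR1 : ∀ x μ, aR x μ ≠ 0 → lo + 1 ≤ x ∧ x + unitVec μ + 1 ≤ hi := fun x μ hx => ⟨(haRsupp x μ hx).2.1, (haRsupp x μ hx).2.2.1⟩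
    have hM9 : ∑ μ, ∑ ν', ∑ y ∈ box z₀ (ℓ0 : ℤ), |wt y μ ν'| ≤ 9 * (((F.L : ℝ)) ^ 2) ^ j := by rw [hFL]; exact hM0
    have h : ∑ b : PBond (F.P K) 0, ‖u α b‖ ^ 2 ≤
        122 * (42 * (F.L : ℝ) + 85) ^ 3 * ((∑ e' : Fin 3, |latticeGreen (unitVec e') - latticeGreen (0 : Zd 3)|) + C₁k) ^ 2 * (F.L : ℝ) ^ (16 * j) :=
      GrossTransferStubLinTestMassRow.mass_row_le F K hNbox hC₁k (fun e w m hm hw => (hKer e).1 w m hm hw) wt βt at' z₀ ℓ0 hβt hat hM9 χ aR R hχ01 hχ0'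
        haR haR1 hRle u0 hu0 hu0off α
    rw [hFL, ← hK₀] at h
    refine h.trans ?_
    have hL0 : (0 : ℝ) ≤ (L : ℝ) := Nat.cast_nonneg L
    calc 122 * (42 * (L : ℝ) + 85) ^ 3 * (K₀ + C₁k) ^ 2 * (L : ℝ) ^ (16 * j) = C6 * (L : ℝ) ^ (16 * j) := by rw [hC6]
      _ ≤ C * (L : ℝ) ^ (16 * j) := mul_le_mul_of_nonneg_right hCge6 (pow_nonneg hL0 _)
  · -- (R7) collar floor — ✓px13 g11 `GrossTransferStubLinTestCollarFloorRow.collarFloor_row_le` over ✓w3 g18 `…TruncatedPotentialCollarMass` (COBD × MONOPOLE × cutoff)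
    have hLpos : 0 < (F.P K).L ^ (3 * j) := pow_pos (lt_of_lt_of_le (by norm_num) F.hL.2) _
    have hRge8 : 8 * (R₀ + 12) ≤ R := by
      rw [hR, mul_comm]
      refine Nat.mul_le_mul_left _ ?_
      calc 8 = 2 ^ 3 := by norm_num
        _ ≤ (F.P K).L ^ 3 := Nat.pow_le_pow_left F.hL.2 3
        _ ≤ (F.P K).L ^ (3 * j) := Nat.pow_le_pow_right (lt_of_lt_of_le (by norm_num) F.hL.2) (by omega)
    obtain ⟨N', hN'⟩ : ∃ N' : ℕ, N' = R - ℓ0 - 4 := ⟨_, rfl⟩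
    have hN2 : 2 ≤ N' := by rw [hN', hℓ0]; omega
    have hNR : (N' : ℤ) + ℓ0 + 4 ≤ R := by
      have : N' + ℓ0 + 4 ≤ R := by rw [hN', hℓ0]; omega
      exact_mod_cast this
    have hRN : R ≤ 2 * N' := by rw [hN', hℓ0]; omega
    have hRL : 12 * F.L ^ (3 * j) ≤ R := by
      have : (F.P K).L = F.L := rfl
      rw [hR, this]; exact Nat.mul_le_mul_right _ (by omega)
    have hM9 : ∑ μ, ∑ ν', ∑ y ∈ box z₀ (ℓ0 : ℤ), |wt y μ ν'| ≤ 9 * (((F.L : ℝ)) ^ 2) ^ j := by rw [hFL]; exact hM0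
    have h := GrossTransferStubLinTestCollarFloorRow.collarFloor_row_le' F K hNbox hC₁k hC₂k (fun e w n hn hw => (hKer e).1 w n hn hw)
      (fun e w n hn hw i => (hKer e).2 w n hn hw i) wt βt at' γt z₀ ℓ0 hβt hat hγt hM9 χ R hχ1 hχ0 hχp hχm hχ2 E1 C2 σ δσ hE1 hC2 hσ hδσ W hW ω hω hωoff
      n hn N' hN2 hNR hRN hRL
    have hL0 : (0 : ℝ) ≤ (L : ℝ) := Nat.cast_nonneg L
    rw [hFL] at h
    have e9 : (n : ℝ) * ∑ b : PBond (F.P K) 0, ω9 b = 9 / 2 * ((n : ℝ) * ∑ b : PBond (F.P K) 0, ω b) := by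
      simp only [hω9]; rw [← Finset.mul_sum]; ring
    rw [e9]
    calc 9 / 2 * ((n : ℝ) * ∑ b : PBond (F.P K) 0, ω b) ≤ 9 / 2 * (9072 * 370440 ^ 2 * (C₁k + C₂k) ^ 2 * (L : ℝ) ^ j) := by linarith only [h]
      _ = C7 * (L : ℝ) ^ j := by rw [hC7]; ring
      _ ≤ C * (L : ℝ) ^ j := mul_le_mul_of_nonneg_right hCge7 (pow_nonneg hL0 _)
  · -- (R8) pointwise on the event — ✓`GrossTransferStubLinTestPointwiseRow.pointwise_row` (P1–P8 over (Q)(W)(I-a)(I-b)(N), ✓Assembly, ✓P6 BianchiTerm, ✓P7 CollarTerm)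
    intro U hU
    have hχ0' : ∀ x, x ∉ box z₀ (3 * (R : ℤ)) → χ x = 0 := fun x hx => hχ0 x hx
    have haR1 : ∀ x μ, aR x μ ≠ 0 → lo + 1 ≤ x ∧ x + unitVec μ + 1 ≤ hi := fun x μ hx => ⟨(haRsupp x μ hx).2.1, (haRsupp x μ hx).2.2.1⟩
    have hlo_eq : ∀ κ, lo κ = z₀ κ - (3 * (R : ℤ) + 2) := fun κ => by simp only [hlo]
    have hhi_eq : ∀ κ, hi κ = z₀ κ + (3 * (R : ℤ) + 4) := fun κ => by simp only [hhi]
    have hCge36 : (36 : ℝ) ≤ C := le_trans (by rw [hCbox]; have : (0:ℝ) ≤ L := Nat.cast_nonneg L; linarith only [this]) hCge4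
    have h := GrossTransferStubLinTestPointwiseRow.pointwise_row F K hFL hγ hγ8 hj hKj260 a cn hcnj hcn z₀ hz₀ R₀ hR₀ R hR hlo_eq hhi_eq hn
      (fun κ => (hbox κ).2) (by omega) hNbox ℓ0 hℓ0 hℓ0lt wt βt at' γt hwt hβt hat hγt χ hχ01 hχ1 hχ0' aR haR daR hdaR haR1 u0 hu0 hu0off
      E1 C2 σ δσ hE1 hC2 hσ hδσ W hW ω hω hωoff hM0 hC₁k (fun e w m hm hw => (hKer e).1 w m hm hw) K₀ hK₀ hCE hC8 hCge8 hCge36 U hU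
    simpa only [hu, hτ, hω9] using h

/-- ★★★ **THE POINTWISE PACKAGE OF `stub_linTest`** — the hypothesis `hP` of ✓`GrossTransferStubLinTestOfPointwise.stub_linTest_of_pointwisePackage'` (`c = 16`, `N = 260`, `γ₁ = 1∕8`).
[cite: GrossCMP1983, Thm 2.2] -/
theorem pointwisePackage :
    ∀ (L : ℕ), ∃ (C : ℝ) (c N : ℕ), 0 ≤ C ∧ 0 < N ∧ ∃ γ₁ : ℝ, 0 < γ₁ ∧ γ₁ ≤ 1 ∧
        ∀ (F : T3Family) (γ : ℝ), F.L = L → 0 < γ → γ ≤ γ₁ → ∀ (K j : ℕ), 1 ≤ j → N * j ≤ K →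
          ∀ a : Plaq (F.P K) j, a.μ.val = 1 → a.ν.val = 2 →
            ∃ (lo hi : Fin (F.P K).d → ℤ) (n : ℕ) (u : Fin 3 → PBond (F.P K) 0 → Matrix (Fin 2) (Fin 2) ℂ)
              (ω : PBond (F.P K) 0 → ℝ),
              (∀ κ, lo κ ≤ hi κ ∧ hi κ ≤ lo κ + n) ∧ 2 * n + 6 ≤ (F.P K).sitesPerDir 0 ∧
              (∀ α b, star (u α b) = -(u α b) ∧ (u α b).trace = 0) ∧
              (∀ α b, u α b ≠ 0 → ∃ x : Fin (F.P K).d → ℤ,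
                  lo + 1 ≤ x ∧ x + e b.dir + 1 ≤ hi ∧ b.src = castSite x ∧ lowPart b.dir (x - lo) ≠ 0) ∧
              (n : ℝ) ≤ C * (L : ℝ) ^ (c * j) ∧
              (∀ α, ∑ p : Plaq (F.P K) 0, ‖u α (slotBond p 0) + u α (slotBond p 1) - u α (slotBond p 2) - u α (slotBond p 3)‖ ^ 2 ≤ C * (L : ℝ) ^ j) ∧
              (∀ α, ∑ b : PBond (F.P K) 0, ‖u α b‖ ^ 2 ≤ C * (L : ℝ) ^ (c * j)) ∧
              (∀ b, 0 ≤ ω b) ∧ (∀ b, ω b ≠ 0 → b ∈ (boxBonds lo hi : Set (PBond (F.P K) 0))) ∧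
              (n : ℝ) * ∑ b : PBond (F.P K) 0, ω b ≤ C * (L : ℝ) ^ j ∧
              (∀ U : GaugeField (F.P K) 0 (Matrix.specialUnitaryGroup (Fin 2) ℂ),
                PlaqSmallOn (boxPlaqs lo hi) ((γ * ((L : ℝ)⁻¹) ^ K) ^ ((3 : ℝ) / 8)) U →
                (GaugeGroup.dist1 (GaugeField.plaqHol
                    (Averaging.iter (fun i' => BlockAveraging.blockAvg (P := F.P K) (j := i') ℰp) j U) a)) ^ 2
                  ≤ C * ∑ α, (actionDeriv (fundamentalRep (Fin 2)) (u α) (GaugeField.gaugeAct (axialGauge U lo hi) U)) ^ 2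
                    + ∑ b, ω b * (GaugeGroup.dist1 (GaugeField.gaugeAct (axialGauge U lo hi) U b)) ^ 2
                    + C * (γ * ((L : ℝ)⁻¹) ^ (K - j))) := by
  intro L
  obtain ⟨C, hC, hmain⟩ := main_estimate L
  exact ⟨C, 16, 260, hC, by norm_num, 1 / 8, by norm_num, by norm_num, hmain⟩

end Summit.QuantumFields.YangMills.Theorems.GrossTransferStubLinTestPointwisePackage

end
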